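import Mathlib
import Summits.Ventures.PercRepro2.LocRows
import Summits.Ventures.PercRepro2.LocRows2
import Summits.Ventures.PercRepro2.LocSym
import Summits.Ventures.PercRepro2.DownsetBijection
import Summits.Ventures.PercRepro2.ClassMonoDefs

/-!
# The monotone local injection inside one class (blind cell PercRepro2, night-4 g2; 2026-08-24T05:xxZ)

Fix a source configuration `ζ₀ ∈ M₀ = {h ∉ H_l, o ∈ B_side}` with blue cluster `B = C_B(l)(ζ₀)`. Its CLASS
`cls ζ₀` is the set of sources with the same blue cluster `B` and the same colouring off `touches B`
(only the colouring inside `B` varies).  THEOREM (`exists_classMono`): the class injects into the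
target set `P₀ = {h ∉ H_l, o ∈ R_side}` by a map that recolours only edges touching `B`, only ADDS red
edges inside `B`, has its blue cluster inside `B`, releases no vertex (the whole of `B` lies in the
image's red cluster), and whose images' red clusters avoid the outside red cluster `Y_h` of `h`.

Proof.  The red edge sets inside `B` of the class form a DOWN-SET of the cube `2^{within B}` (removing
red edges inside `B` keeps `B` blue-connected, its boundary red, and `o`, `h` away from the red
cluster); the down-set lemma (`Downset.exists_injOn_of_isDownset`) gives an injection `c ↦ D ⊇ c`
whose complement `W ∖ D` is the red set of another member `ζ̃` of the class.  The image is `D` inside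
`B`, on the boundary of `B` every edge red except the LEAK edges into `Y_h` (blue), and `ζ₀` elsewhere.
Then `B ⊆ C_R(l)` (the blue spanning structure of `ζ̃` is red now; closure lemma in `ζ̃`), the blue
cluster of `l` lies inside `C_R(l)(ζ̃) ∩ B` (closure lemma: the red edges of `ζ̃` inside `B` are the
blue edges of the image, and no leak edge starts at a red-cluster vertex of `ζ̃`), and the red
cluster avoids `Y_h` (closure lemma: every red edge leaving `B` is a non-leak edge).

This is the class-level half of row (LOC0-mono) (`LocRows.LocMono`): the classes share targets across
different blue clusters `B`, and that global coordination is the remaining gap (proofs/NIGHT4-MONO.md).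
-/


namespace Summit.Ventures.PercRepro2

namespace LocRows

open Hull Downset

variable {V : Type*} {E : Type*} [Fintype E] [DecidableEq E]

open scoped Classical

variable (ends : E → Sym2 V)

section Class

variable {l h o : V} {ζ₀ : Config E}

/-- **The class-level monotone injection.**  For every source `ζ₀` there is an injection `f` on its
class with: image in `P₀`; only edges touching `B = C_B(l)(ζ₀)` recoloured; red only added inside `B`;
blue cluster of the image inside `B`; the whole of `B` inside the red cluster of the image (no
release); and the red cluster of the image disjoint from the outside red cluster of `h`. -/
theorem exists_classMono (hζ₀ : ζ₀ ∈ srcU ends l h {S : Set V | o ∈ S}) :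
    ∃ f : Config E → Config E, Set.InjOn f ↑(cls ends l h o ζ₀) ∧
      ∀ ζ ∈ cls ends l h o ζ₀,
        f ζ ∈ tgtU ends l h {S : Set V | o ∈ S} ∧
        LocalAtSet ends (fun ζ => cluster ends (blue ζ) l) ζ (f ζ) ∧
        (∀ e, e ∈ within ends (cluster ends (blue ζ) l) → ζ e = true → f ζ e = true) ∧
        cluster ends (blue (f ζ)) l ⊆ cluster ends (blue ζ) l ∧
        cluster ends (blue ζ) l ⊆ cluster ends (f ζ) l ∧
        Disjoint (cluster ends (f ζ) l) (outsideRed ends (cluster ends (blue ζ₀) l) ζ₀ h) := by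
  set B := cluster ends (blue ζ₀) l with hB
  set Yh := outsideRed ends B ζ₀ h with hYh
  set W : Finset E := Finset.univ.filter fun e => e ∈ within ends B with hW
  set S : Finset (Finset E) := (cls ends l h o ζ₀).image (redW ends B) with hS
  have hhB : h ∉ B := by
    rw [mem_srcU_iff] at hζ₀
    exact fun hh => hζ₀.1 (Or.inr hh)
  have hlB : l ∈ B := mem_cluster_self ends (blue ζ₀) l
  have hSU : ∀ c ∈ S, c ⊆ W := by
    intro c hc
    rw [hS, Finset.mem_image] at hc
    obtain ⟨ζ, _, rfl⟩ := hc
    intro e he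
    simp only [redW, Finset.mem_filter, Finset.mem_univ, true_and] at he
    simp [hW, he.1]
  obtain ⟨fW, hfinj, hfW⟩ := exists_injOn_of_isDownset W S (isDownset_redW_cls ends) hSU
  refine ⟨fun ζ => img ends B Yh ζ₀ (fW (redW ends B ζ)), ?_, ?_⟩
  · -- injectivity
    intro ζ hζ ζ' hζ' heq
    simp only [Finset.mem_coe] at hζ hζ'
    have hζc := hζ; have hζ'c := hζ'
    rw [mem_cls, ← hB] at hζc hζ'c
    have hD : fW (redW ends B ζ) = fW (redW ends B ζ') := by
      ext e
      by_cases hw : e ∈ within ends B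
      · have := congrFun heq e
        simp only [img, hw, if_true] at this
        constructor
        · intro h1; exact of_decide_eq_true (this ▸ decide_eq_true h1)
        · intro h1; exact of_decide_eq_true (this.symm ▸ decide_eq_true h1)
      · have h1 : e ∉ fW (redW ends B ζ) := fun hm => hw (by
          have := (hfW _ (Finset.mem_image_of_mem _ hζ)).2.1 hm
          simpa [hW] using this)
        have h2 : e ∉ fW (redW ends B ζ') := fun hm => hw (by
          have := (hfW _ (Finset.mem_image_of_mem _ hζ')).2.1 hm
          simpa [hW] using this)
        simp [h1, h2]
    have hc : redW ends B ζ = redW ends B ζ' :=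
      hfinj (Finset.mem_coe.2 (Finset.mem_image_of_mem _ hζ))
        (Finset.mem_coe.2 (Finset.mem_image_of_mem _ hζ')) hD
    funext e
    by_cases hw : e ∈ within ends B
    · have := congrArg (fun s => e ∈ s) hc
      simp only [redW, Finset.mem_filter, Finset.mem_univ, true_and, hw, eq_iff_iff] at this
      cases h1 : ζ e <;> cases h2 : ζ' e
      · rfl
      · exact absurd (this.2 (by simp [h2])) (by simp [h1])
      · exact absurd (this.1 (by simp [h1])) (by simp [h2])
      · rfl
    · by_cases ht : e ∈ touches ends B
      · -- a boundary edge of `B`: red in both (boundary of the blue cluster)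
        obtain ⟨x, hx, y, hends⟩ := ht
        have hy : y ∉ B := fun hy => hw (mem_within_of_ends ends hends hx hy)
        have hx1 : x ∈ cluster ends (blue ζ) l := by rw [hζc.2.1]; exact hx
        have hy1 : y ∉ cluster ends (blue ζ) l := by rw [hζc.2.1]; exact hy
        have hx2 : x ∈ cluster ends (blue ζ') l := by rw [hζ'c.2.1]; exact hx
        have hy2 : y ∉ cluster ends (blue ζ') l := by rw [hζ'c.2.1]; exact hy
        have r1 : ζ e = true := red_of_mem_cluster_blue_of_notMem' ends hx1 hy1 hends
        have r2 : ζ' e = true := red_of_mem_cluster_blue_of_notMem' ends hx2 hy2 hends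
        rw [r1, r2]
      · rw [hζc.2.2 e ht, hζ'c.2.2 e ht]
  · intro ζ hζ
    have hζc := hζ
    rw [mem_cls, mem_srcU_iff, ← hB] at hζc
    obtain ⟨⟨hhull, hoB, hoR⟩, hBζ, hoff⟩ := hζc
    set c := redW ends B ζ with hc
    have hcS : c ∈ S := Finset.mem_image_of_mem _ hζ
    obtain ⟨hcD, hDW, hWD⟩ := hfW c hcS
    set D := fW c with hD
    -- the class member whose red set inside `B` is `W ∖ D`
    rw [hS, Finset.mem_image] at hWD
    obtain ⟨ζt, hζt, hζtW⟩ := hWD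
    have hζtc := hζt
    rw [mem_cls, mem_srcU_iff, ← hB] at hζtc
    obtain ⟨⟨hhullt, hoBt, hoRt⟩, hBt, hofft⟩ := hζtc
    set ζ' : Config E := img ends B Yh ζ₀ D with hζ'
    -- basic facts on `ζ'`
    have hζ'_within : ∀ e, e ∈ within ends B → (ζ' e = true ↔ e ∈ D) := by
      intro e hw; simp [hζ', img, hw]
    have hζ'_bnd : ∀ e, e ∉ within ends B → e ∈ touches ends B → (ζ' e = true ↔ e ∉ leak ends B Yh) := by
      intro e hw ht; simp [hζ', img, hw, ht]
    have hζ'_off : ∀ e, e ∉ touches ends B → ζ' e = ζ₀ e := by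
      intro e ht
      have hw : e ∉ within ends B := fun hw => ht (within_subset_touches ends B hw)
      simp [hζ', img, hw, ht]
    -- red inside `B` in `ζt` ↔ blue inside `B` in `ζ'`
    have ht_red_iff : ∀ e, e ∈ within ends B → (ζt e = true ↔ ζ' e = false) := by
      intro e hw
      have h1 : e ∈ redW ends B ζt ↔ e ∈ W \ D := by rw [hζtW]
      simp only [redW, Finset.mem_filter, Finset.mem_univ, true_and, Finset.mem_sdiff, hW, hw] at h1
      rw [h1]
      have h2 := hζ'_within e hw
      constructor
      · intro hnD
        cases h3 : ζ' e
        · rfl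
        · exact absurd (h2.1 h3) hnD
      · intro h3 hD
        have := h2.2 hD
        rw [h3] at this
        exact Bool.false_ne_true this
    -- boundary edges of `B` are red in `ζt`
    have ht_bnd_red : ∀ e x y, ends e = s(x, y) → x ∈ B → y ∉ B → ζt e = true := by
      intro e x y hends hx hy
      have hx' : x ∈ cluster ends (blue ζt) l := by rw [hBt]; exact hx
      have hy' : y ∉ cluster ends (blue ζt) l := by rw [hBt]; exact hy
      exact red_of_mem_cluster_blue_of_notMem' ends hx' hy' hends
    -- a leak edge never starts at a red-cluster vertex of `ζt`
    have hdel_le : delConfig ends B ζ₀ ≤ ζt := delConfig_le_of_eq_off ends hofft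
    have hYh_not_red : ∀ y ∈ Yh, y ∉ cluster ends ζt l := by
      intro y hy hyR
      apply hhullt
      left
      have hconn : Conn ends ζt h y := conn_mono hdel_le hy
      exact conn_trans hyR (conn_symm hconn)
    -- (iii) `B ⊆ C_R(l)(ζ')`
    have hBsub : B ⊆ cluster ends ζ' l := by
      have hclosed : ∀ a ∈ (cluster ends ζ' l ∪ Bᶜ : Set V), ∀ b,
          (openGraph ends (blue ζt)).Adj a b → b ∈ (cluster ends ζ' l ∪ Bᶜ : Set V) := by
        intro a ha b hab
        obtain ⟨_, e, he, hends⟩ := exists_edge_of_adj hab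
        rw [blue_apply] at he
        by_cases hbB : b ∈ B
        · rcases ha with haR | haB
          · have haB : a ∈ B := by
              by_contra haB
              have := ht_bnd_red e b a (ends_swap hends) hbB haB
              rw [this] at he; exact Bool.false_ne_true he
            have hw : e ∈ within ends B := mem_within_of_ends ends hends haB hbB
            have hζt_false : ζt e = false := by
              cases h1 : ζt e
              · rfl
              · rw [h1] at he; exact absurd he (by decide)
            have hred : ζ' e = true := by
              cases hζ'e : ζ' e
              · have := (ht_red_iff e hw).2 hζ'e
                rw [hζt_false] at this
                exact absurd this (by decide)
              · rfl
            exact Or.inl (mem_cluster_of_edge haR hred hends)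
          · exfalso
            have := ht_bnd_red e b a (ends_swap hends) hbB haB
            rw [this] at he; exact Bool.false_ne_true he
        · exact Or.inr hbB
      intro u hu
      have hu' : u ∈ cluster ends (blue ζt) l := by rw [hBt]; exact hu
      have := mem_of_conn_of_closed hclosed (v := l) (Or.inl (mem_cluster_self ends ζ' l)) hu'
      rcases this with h1 | h1
      · exact h1
      · exact absurd hu h1
    -- (iv) `C_B(l)(ζ') ⊆ C_R(l)(ζt) ∩ B`
    have hBLsub : cluster ends (blue ζ') l ⊆ cluster ends ζt l ∩ B := by
      have hclosed : ∀ a ∈ (cluster ends ζt l ∩ B : Set V), ∀ b,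
          (openGraph ends (blue ζ')).Adj a b → b ∈ (cluster ends ζt l ∩ B : Set V) := by
        intro a ⟨haR, haB⟩ b hab
        obtain ⟨_, e, he, hends⟩ := exists_edge_of_adj hab
        rw [blue_apply] at he
        have he' : ζ' e = false := by
          cases h1 : ζ' e
          · rfl
          · rw [h1] at he; exact absurd he (by decide)
        by_cases hw : e ∈ within ends B
        · have hred : ζt e = true := (ht_red_iff e hw).2 he'
          exact ⟨mem_cluster_of_edge haR hred hends, (endpoints_of_within ends hends hw).2⟩
        · have ht : e ∈ touches ends B := mem_touches_of_ends hends (Or.inl haB)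
          have hleak : e ∈ leak ends B Yh := by
            by_contra hl
            have := (hζ'_bnd e hw ht).2 hl
            rw [this] at he'; exact absurd he' (by decide)
          exfalso
          rcases leak_endpoints ends hends hleak with ⟨_, hbY⟩ | ⟨_, haY⟩
          · have hbB : b ∉ B := fun hb => hw (mem_within_of_ends ends hends haB hb)
            have hredt : ζt e = true := ht_bnd_red e a b hends haB hbB
            exact hYh_not_red b hbY (mem_cluster_of_edge haR hredt hends)
          · exact outsideRed_disjoint ends hhB haB haY
      intro u hu
      exact mem_of_conn_of_closed hclosed (v := l) ⟨mem_cluster_self ends ζt l, hlB⟩ hu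
    -- (v) `C_R(l)(ζ')` avoids `Yh`
    have hRdisj : Disjoint (cluster ends ζ' l) Yh := by
      rw [Set.disjoint_left]
      have hclosed : ∀ a ∈ (Yhᶜ : Set V), ∀ b, (openGraph ends ζ').Adj a b → b ∈ (Yhᶜ : Set V) := by
        intro a ha b hab
        obtain ⟨_, e, he, hends⟩ := exists_edge_of_adj hab
        intro hbY
        by_cases hw : e ∈ within ends B
        · exact outsideRed_disjoint ends hhB (endpoints_of_within ends hends hw).2 hbY
        · by_cases ht : e ∈ touches ends B
          · have hnl : e ∉ leak ends B Yh := (hζ'_bnd e hw ht).1 he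
            rcases endpoints_mem_of_touches ends hends ht with haB | hbB
            · exact hnl ⟨a, haB, b, hbY, hends⟩
            · exact outsideRed_disjoint ends hhB hbB hbY
          · have h0 : ζ₀ e = true := by rw [← hζ'_off e ht]; exact he
            have hd : delConfig ends B ζ₀ e = true := by rw [delConfig_apply_of_notMem ht]; exact h0
            exact ha (mem_cluster_of_edge hbY hd (ends_swap hends))
      intro u hu
      exact mem_of_conn_of_closed hclosed (v := l) (fun hl => outsideRed_disjoint ends hhB hlB hl) hu
    have hhY : h ∈ Yh := mem_cluster_self ends _ h
    have hoB' : o ∈ B := by rw [← hBζ]; exact hoB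
    refine ⟨?_, ?_, ?_, ?_, ?_, hRdisj⟩
    · rw [mem_tgtU_iff]
      refine ⟨?_, hBsub hoB', ?_⟩
      · intro hh
        rcases hh with hR | hBl
        · exact (Set.disjoint_left.1 hRdisj) hR hhY
        · exact hhB (hBLsub hBl).2
      · exact fun ho => hoRt (hBLsub ho).1
    · intro e he
      by_contra ht
      have ht' : e ∉ touches ends B := by
        simpa only [hBζ] using ht
      exact he (hζ'_off e ht' ▸ hoff e ht').symm
    · intro e hw he
      rw [hBζ] at hw
      have : e ∈ c := by simp [hc, redW, hw, he]
      exact (hζ'_within e hw).2 (hcD this)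
    · rw [hBζ]; exact fun u hu => (hBLsub hu).2
    · rw [hBζ]; exact hBsub

end Class

end LocRows

end Summit.Ventures.PercRepro2
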